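import Mathlib
import HarnessLib
import Summits.Ventures.LatticeQCDFlow.TrivializingMaps.AcceptanceCurveSwap

/-!
# The swap-distance form of the full acceptance curve (THEOREM Q♯♯ on all of `[½, 1]`), II:
# the anti-aligned half, unconditionally

HONEST FRAMING. exact (Metropolis-corrected) sampling algorithms for lattice gauge theory; figures of
merit are autocorrelation/cost numbers at stated couplings and volumes; no continuum-physics claim.

Setting and notation as in `TrivializingMaps.AcceptanceCurveSwap` (imported): probability vectors
`x, y ≥ 0` on `{±1}²`, `S = Σ_{z,w} min (x_z y_w, x_w y_z)`, `det x = x₊₊ x₋₋ - x₊₋ x₋₊`, corner masses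
`a = x₊₊, b = x₋₋, e = x₊₋, f = x₋₊`, `c = y₊₊, d = y₋₋, g = y₊₋, h = y₋₊`, block lower bound
`L = |a + b - c - d| + |a d - b c| + |e h - f g| ≤ 1 - S` (`swapDefect_ge_block` there).

## What is proved (all `sorry`-free; NO definition is introduced; nothing is assumed)
* `block_lower` (one block: an explicit polynomial identity with nonnegative remainder),
  `two_block_sum` (a two-term Cauchy–Schwarz aggregation), `lower_half` (masses form: `L ≤ ½` and
  `c + d ≤ a + b ⟹ (c d - g h) - (a b - e f) ≤ L (1 - L)`) — the ANTI-ALIGNED HALF of the block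
  inequality that `AcceptanceCurveSwap` §3 carries as the hypothesis `hB`.
* `det_sub_det_le_of_diag_le`: `S ≥ ½` and `x₊₊ + x₋₋ ≤ y₊₊ + y₋₋ ⟹ det x - det y ≤ S (1 - S)`;
  `curve_of_diag_le`: then `½ ≤ t ≤ S ⟹ (2t-1)² ≤ 1 - 4 (det x - det y)`.
* `sum_min_curve_antiAligned` (product models `y = (p', 1-p') ⊗ (q', 1-q')`, `det y = 0`, exact
  hypothesis form of `AcceptanceCurveFourPoint.sum_min_curve`): on the WHOLE range `½ ≤ t ≤ S`,
  `(2t-1)² ≤ 1 - 4 det x` if `x₊₊ + x₋₋ ≤ p'q' + (1-p')(1-q')`, `(2t-1)² ≤ 1 + 4 det x` if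
  `x₊₊ + x₋₋ ≥ p'q' + (1-p')(1-q')`; hence clause (ii) of `sum_min_curve`,
  `(2t-1)² ≤ 1 - 4 |det x|`, with NO regime hypothesis whenever
  `(x₊₊ + x₋₋ - p'q' - (1-p')(1-q')) · det x ≤ 0`.

## NOT CLAIMED
The ALIGNED half (`(x(diag) - y(diag)) · (det x - det y) > 0`), hence the unconditional two-sided
curve `(2t-1)² ≤ 1 - 4 |det x|` for every target/model pair: numerically certified only (cell file
THEORY-1.md §35 records its proof architecture and the one uncertified leaf).  Nothing about lattice
gauge theory proper.

References: `AcceptanceCurveSwap`, `AcceptanceCurveFourPoint`, THEOREM Q (`AcceptanceFootprint*`);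
M. Lüscher, CMP 293 (2010) [Luscher2010Trivializing] (context only).
-/

namespace Summit.Ventures.LatticeQCDFlow.TrivializingMaps.Curve

/-! ## The anti-aligned half, unconditionally

The block inequality splits into two one-sided halves according to the sign of
`(x(diag) - y(diag)) · (det x - det y)`.  The ANTI-ALIGNED half (`≤ 0`) has a short proof, given
here in full: per block, `(2w)(X)(-Φ) + 2ℓ² ≤ (2w)(X) ℓ` (`block_lower`, an explicit identity with a
manifestly nonnegative remainder), then a two-term Cauchy–Schwarz step (`two_block_sum`). -/

/-- **Block lemma (lower side).**  Heavy masses `A, B`, light masses `C, D` on the two atoms of a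
block (`C + D ≤ A + B`), orientation `B C ≤ A D`.  Then
`(A+B+C+D)(A+B)(C D - A B) + 2 (A D - B C)² ≤ (A+B+C+D)(A+B)(A D - B C)`; indeed the difference is
`2 (A+B+C+D) B (A D - B C) + (A+B-C-D)(A+B)(A+C)(B+D) ≥ 0`. -/
theorem block_lower (A B C D : ℝ) (hA : 0 ≤ A) (hB : 0 ≤ B) (hC : 0 ≤ C) (hD : 0 ≤ D)
    (hτ : C + D ≤ A + B) (hℓ : B * C ≤ A * D) :
    (A + B + C + D) * (A + B) * (C * D - A * B) + 2 * (A * D - B * C) ^ 2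
      ≤ (A + B + C + D) * (A + B) * (A * D - B * C) := by
  have key : (A + B + C + D) * (A + B) * (A * D - B * C)
      - ((A + B + C + D) * (A + B) * (C * D - A * B) + 2 * (A * D - B * C) ^ 2)
      = 2 * ((A + B + C + D) * B * (A * D - B * C))
        + (A + B - (C + D)) * (A + B) * (A + C) * (B + D) := by ring
  have h1 : 0 ≤ (A + B + C + D) * B * (A * D - B * C) :=
    mul_nonneg (mul_nonneg (by linarith) hB) (by linarith)
  have h2 : 0 ≤ (A + B - (C + D)) * (A + B) * (A + C) * (B + D) :=
    mul_nonneg (mul_nonneg (mul_nonneg (by linarith) (by linarith)) (by linarith)) (by linarith)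
  linarith

/-- **Two-block aggregation (Cauchy–Schwarz).**  From `mᵢ Pᵢ + ℓᵢ² ≤ mᵢ ℓᵢ` (`i = 1, 2`) with
`m₁ + m₂ ≤ 1`: `P₁ + P₂ ≤ (ℓ₁ + ℓ₂) - (ℓ₁ + ℓ₂)²`. -/
theorem two_block_sum (P₁ P₂ ℓ₁ ℓ₂ m₁ m₂ : ℝ) (hm₁ : 0 ≤ m₁) (hm₂ : 0 ≤ m₂) (hms : m₁ + m₂ ≤ 1)
    (h₁ : m₁ * P₁ + ℓ₁ ^ 2 ≤ m₁ * ℓ₁) (h₂ : m₂ * P₂ + ℓ₂ ^ 2 ≤ m₂ * ℓ₂)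
    (hz₁ : m₁ = 0 → P₁ = 0 ∧ ℓ₁ = 0) (hz₂ : m₂ = 0 → P₂ = 0 ∧ ℓ₂ = 0) :
    P₁ + P₂ ≤ (ℓ₁ + ℓ₂) - (ℓ₁ + ℓ₂) ^ 2 := by
  rcases eq_or_lt_of_le hm₁ with h1 | h1
  · obtain ⟨hP, hl⟩ := hz₁ h1.symm
    rcases eq_or_lt_of_le hm₂ with h2 | h2
    · obtain ⟨hP', hl'⟩ := hz₂ h2.symm
      simp [hP, hl, hP', hl']
    · rw [hP, hl]
      have : m₂ * P₂ ≤ m₂ * (ℓ₂ - ℓ₂ ^ 2) := by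
        nlinarith [mul_nonneg (sq_nonneg ℓ₂) (by linarith : 0 ≤ 1 - m₂)]
      have := le_of_mul_le_mul_left this h2
      simpa using this
  · rcases eq_or_lt_of_le hm₂ with h2 | h2
    · obtain ⟨hP', hl'⟩ := hz₂ h2.symm
      rw [hP', hl']
      have : m₁ * P₁ ≤ m₁ * (ℓ₁ - ℓ₁ ^ 2) := by
        nlinarith [mul_nonneg (sq_nonneg ℓ₁) (by linarith : 0 ≤ 1 - m₁)]
      have := le_of_mul_le_mul_left this h1
      simpa using this
    · have e1 := mul_le_mul_of_nonneg_left h₁ hm₂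
      have e2 := mul_le_mul_of_nonneg_left h₂ hm₁
      have hsq := sq_nonneg (ℓ₁ * m₂ - ℓ₂ * m₁)
      have hmix : 0 ≤ (m₂ * ℓ₁ ^ 2 + m₁ * ℓ₂ ^ 2) * (1 - (m₁ + m₂)) :=
        mul_nonneg (by positivity) (by linarith)
      have hkey : (m₁ * m₂) * (P₁ + P₂) ≤ (m₁ * m₂) * ((ℓ₁ + ℓ₂) - (ℓ₁ + ℓ₂) ^ 2) := by
        nlinarith
      exact le_of_mul_le_mul_left hkey (mul_pos h1 h2)

/-- **The anti-aligned half of the block inequality (unconditional).**  Masses as in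
`AcceptanceCurveSwap` §1, with `x` the heavier measure on the diagonal block (`c + d ≤ a + b`) and
the orientations `b c ≤ a d`,
`f g ≤ e h`; `L = (a + b - c - d) + (a d - b c) + (e h - f g) ≤ ½`.  Then
`(c d - g h) - (a b - e f) ≤ L (1 - L)`  (i.e. `det y - det x ≤ L (1 - L)`). -/
theorem lower_half (a b c d e f g h : ℝ) (ha : 0 ≤ a) (hb : 0 ≤ b) (hc : 0 ≤ c) (hd : 0 ≤ d)
    (he : 0 ≤ e) (hf : 0 ≤ f) (hg : 0 ≤ g) (hh : 0 ≤ h)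
    (hx : a + b + e + f = 1) (hy : c + d + g + h = 1)
    (hτ : c + d ≤ a + b) (h1 : b * c ≤ a * d) (h2 : f * g ≤ e * h)
    (hL : (a + b - c - d) + (a * d - b * c) + (e * h - f * g) ≤ 1 / 2) :
    (c * d - g * h) - (a * b - e * f)
      ≤ ((a + b - c - d) + (a * d - b * c) + (e * h - f * g))
          * (1 - ((a + b - c - d) + (a * d - b * c) + (e * h - f * g))) := by
  have B1 := block_lower a b c d ha hb hc hd hτ h1
  have B2 := block_lower h g f e hh hg hf he (by linarith) (by linarith)
  have hagg := two_block_sum (c * d - a * b) (e * f - g * h) (a * d - b * c) (e * h - f * g)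
    ((a + b + c + d) * (a + b) / 2) ((e + f + g + h) * (g + h) / 2)
    (by positivity) (by positivity) ?_ (by nlinarith [B1]) (by nlinarith [B2]) ?_ ?_
  · have hΛ : 0 ≤ (a * d - b * c) + (e * h - f * g) := by linarith
    nlinarith [mul_nonneg (by linarith : (0:ℝ) ≤ a + b - c - d)
      (by linarith : (0:ℝ) ≤ 1 - (a + b - c - d) - 2 * ((a * d - b * c) + (e * h - f * g)))]
  · -- `m₁ + m₂ ≤ 1`
    have hef : e + f + g + h = (1 - (a + b)) + (1 - (c + d)) := by linarith
    have hgh : g + h = 1 - (c + d) := by linarith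
    rw [hef, hgh]
    have hX1 : a + b ≤ 1 := by linarith
    nlinarith [mul_nonneg (by linarith : 0 ≤ a + b) (by linarith : 0 ≤ 1 - (a + b)),
      mul_nonneg (by linarith : 0 ≤ c + d) (by linarith : 0 ≤ 1 - (a + b)),
      mul_nonneg (by linarith : 0 ≤ c + d) (by linarith : 0 ≤ 1 - (c + d))]
  · intro hm
    have hab : (a + b + c + d) * (a + b) = 0 := by linarith
    have hab' : a + b = 0 := by
      rcases mul_eq_zero.1 hab with h0 | h0 <;> linarith
    have ha0 : a = 0 := by linarith
    have hb0 : b = 0 := by linarith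
    have hc0 : c = 0 := by linarith
    have hd0 : d = 0 := by linarith
    subst ha0 hb0 hc0 hd0; simp
  · intro hm
    have hgh0 : (e + f + g + h) * (g + h) = 0 := by linarith
    have hgh' : g + h = 0 := by
      rcases mul_eq_zero.1 hgh0 with h0 | h0 <;> linarith
    have hg0 : g = 0 := by linarith
    have hh0 : h = 0 := by linarith
    have he0 : e = 0 := by linarith
    have hf0 : f = 0 := by linarith
    subst hg0 hh0 he0 hf0; simp

/-- **`det x - det y ≤ S (1 - S)` whenever `S ≥ ½` and the model carries at least as much diagonal
mass as the target (`x₊₊ + x₋₋ ≤ y₊₊ + y₋₋`) — unconditional.** -/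
theorem det_sub_det_le_of_diag_le (x y : Bool × Bool → ℝ)
    (hx0 : ∀ z, 0 ≤ x z) (hy0 : ∀ z, 0 ≤ y z)
    (hxs : x (true, true) + x (true, false) + x (false, true) + x (false, false) = 1)
    (hys : y (true, true) + y (true, false) + y (false, true) + y (false, false) = 1)
    (hdiag : x (true, true) + x (false, false) ≤ y (true, true) + y (false, false))
    (hS : 1 / 2 ≤ ∑ z : Bool × Bool, ∑ w : Bool × Bool, min (x z * y w) (x w * y z)) :
    (x (true, true) * x (false, false) - x (true, false) * x (false, true))
        - (y (true, true) * y (false, false) - y (true, false) * y (false, true))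
      ≤ (∑ z : Bool × Bool, ∑ w : Bool × Bool, min (x z * y w) (x w * y z))
          * (1 - ∑ z : Bool × Bool, ∑ w : Bool × Bool, min (x z * y w) (x w * y z)) := by
  set S := ∑ z : Bool × Bool, ∑ w : Bool × Bool, min (x z * y w) (x w * y z) with hSdef
  have hblk := swapDefect_ge_block x y hxs hys
  rw [← hSdef] at hblk
  -- the masses, with `y` as the heavy measure on the diagonal block
  have hτabs : |x (true, true) + x (false, false) - y (true, true) - y (false, false)|
      = y (true, true) + y (false, false) - x (true, true) - x (false, false) := by
    rw [abs_of_nonpos (by linarith)]; ring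
  rw [hτabs] at hblk
  -- four orientation cases
  have main : ∀ a b c d e f g h : ℝ, 0 ≤ a → 0 ≤ b → 0 ≤ c → 0 ≤ d → 0 ≤ e → 0 ≤ f → 0 ≤ g →
      0 ≤ h → a + b + e + f = 1 → c + d + g + h = 1 → c + d ≤ a + b →
      (a + b - c - d) + |a * d - b * c| + |e * h - f * g| ≤ 1 - S →
      (c * d - g * h) - (a * b - e * f) ≤ S * (1 - S) := by
    intro a b c d e f g h ha hb hc hd he hf hg hh hx hy hτ hL
    have hS1 : 1 - S ≤ 1 / 2 := by linarith
    have mono : ∀ L : ℝ, 0 ≤ L → L ≤ 1 - S → L * (1 - L) ≤ S * (1 - S) := by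
      intro L hL0 hL1; nlinarith
    rcases le_total (b * c) (a * d) with h1 | h1 <;> rcases le_total (f * g) (e * h) with h2 | h2
    · rw [abs_of_nonneg (by linarith), abs_of_nonneg (by linarith)] at hL
      exact (lower_half a b c d e f g h ha hb hc hd he hf hg hh hx hy hτ h1 h2 (by linarith)).trans
        (mono _ (by linarith) hL)
    · rw [abs_of_nonneg (by linarith), abs_of_nonpos (by linarith)] at hL
      have key := lower_half a b c d f e h g ha hb hc hd hf he hh hg (by linarith) (by linarith) hτ h1
        h2 (by linarith)
      have m := mono ((a + b - c - d) + (a * d - b * c) + (f * g - e * h)) (by linarith) (by linarith)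
      linarith [key, m, mul_comm h g, mul_comm f e]
    · rw [abs_of_nonpos (by linarith), abs_of_nonneg (by linarith)] at hL
      have key := lower_half b a d c e f g h hb ha hd hc he hf hg hh (by linarith) (by linarith)
        (by linarith) h1 h2 (by linarith)
      have m := mono ((b + a - d - c) + (b * c - a * d) + (e * h - f * g)) (by linarith) (by linarith)
      linarith [key, m, mul_comm d c, mul_comm b a]
    · rw [abs_of_nonpos (by linarith), abs_of_nonpos (by linarith)] at hL
      have key := lower_half b a d c f e h g hb ha hd hc hf he hh hg (by linarith) (by linarith)
        (by linarith) h1 h2 (by linarith)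
      have m := mono ((b + a - d - c) + (b * c - a * d) + (f * g - e * h)) (by linarith) (by linarith)
      linarith [key, m, mul_comm d c, mul_comm b a, mul_comm h g, mul_comm f e]
  have := main (y (true, true)) (y (false, false)) (x (true, true)) (x (false, false))
    (y (true, false)) (y (false, true)) (x (true, false)) (x (false, true))
    (hy0 _) (hy0 _) (hx0 _) (hx0 _) (hy0 _) (hy0 _) (hx0 _) (hx0 _)
    (by linarith) (by linarith) hdiag ?_
  · linarith
  · have e1 : |y (true, true) * x (false, false) - y (false, false) * x (true, true)|
        = |x (true, true) * y (false, false) - x (false, false) * y (true, true)| := by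
      rw [← abs_neg]; ring_nf
    have e2 : |y (true, false) * x (false, true) - y (false, true) * x (true, false)|
        = |x (true, false) * y (false, true) - x (false, true) * y (true, false)| := by
      rw [← abs_neg]; ring_nf
    rw [e1, e2]; linarith

/-- **The anti-aligned half of the curve, unconditionally.**  `½ ≤ t ≤ S` and
`x₊₊ + x₋₋ ≤ y₊₊ + y₋₋` give `(2 t - 1)² ≤ 1 - 4 (det x - det y)`. -/
theorem curve_of_diag_le (x y : Bool × Bool → ℝ)
    (hx0 : ∀ z, 0 ≤ x z) (hy0 : ∀ z, 0 ≤ y z)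
    (hxs : x (true, true) + x (true, false) + x (false, true) + x (false, false) = 1)
    (hys : y (true, true) + y (true, false) + y (false, true) + y (false, false) = 1)
    (hdiag : x (true, true) + x (false, false) ≤ y (true, true) + y (false, false)) {t : ℝ}
    (ht : t ≤ ∑ z : Bool × Bool, ∑ w : Bool × Bool, min (x z * y w) (x w * y z)) (ht2 : 1 / 2 ≤ t) :
    (2 * t - 1) ^ 2 ≤ 1 - 4 * ((x (true, true) * x (false, false) - x (true, false) * x (false, true))
        - (y (true, true) * y (false, false) - y (true, false) * y (false, true))) := by
  have h := det_sub_det_le_of_diag_le x y hx0 hy0 hxs hys hdiag (ht2.trans ht)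
  set S := ∑ z : Bool × Bool, ∑ w : Bool × Bool, min (x z * y w) (x w * y z)
  have hS1 : S ≤ 1 := by
    have := swapDefect_ge_block x y hxs hys
    have h0 : 0 ≤ |x (true, true) + x (false, false) - y (true, true) - y (false, false)|
        + |x (true, true) * y (false, false) - x (false, false) * y (true, true)|
        + |x (true, false) * y (false, true) - x (false, true) * y (true, false)| := by positivity
    linarith
  nlinarith

/-- **Product models, anti-aligned half (unconditional).**  If the product model puts at least as
much mass on the diagonal corners as the target, `x₊₊ + x₋₋ ≤ p'q' + (1-p')(1-q')`, then on the
whole range `½ ≤ t ≤` (sixteen-term mean acceptance): `(2 t - 1)² ≤ 1 - 4 (x₊₊ x₋₋ - x₊₋ x₋₊)`;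
symmetrically, if `p'q' + (1-p')(1-q') ≤ x₊₊ + x₋₋` then `(2 t - 1)² ≤ 1 + 4 (x₊₊ x₋₋ - x₊₋ x₋₊)`.
In particular clause (ii) of `sum_min_curve` holds unconditionally whenever
`(x₊₊ + x₋₋ - p'q' - (1-p')(1-q')) · (x₊₊ x₋₋ - x₊₋ x₋₊) ≤ 0`. -/
theorem sum_min_curve_antiAligned (x : Bool × Bool → ℝ) {p' q' t : ℝ}
    (hx0 : ∀ z, 0 ≤ x z)
    (hs : x (true, true) + x (true, false) + x (false, true) + x (false, false) = 1) (hp0 : 0 ≤ p')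
    (hp1 : p' ≤ 1) (hq0 : 0 ≤ q') (hq1 : q' ≤ 1)
    (ht : t ≤ ∑ z : Bool × Bool, ∑ w : Bool × Bool,
        min (x z * ((if w.1 then p' else 1 - p') * (if w.2 then q' else 1 - q')))
          (x w * ((if z.1 then p' else 1 - p') * (if z.2 then q' else 1 - q'))))
    (ht2 : 1 / 2 ≤ t) :
    (x (true, true) + x (false, false) ≤ p' * q' + (1 - p') * (1 - q') →
      (2 * t - 1) ^ 2 ≤ 1 - 4 * (x (true, true) * x (false, false) - x (true, false) * x (false, true)))
    ∧ (p' * q' + (1 - p') * (1 - q') ≤ x (true, true) + x (false, false) →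
      (2 * t - 1) ^ 2 ≤ 1 + 4 * (x (true, true) * x (false, false) - x (true, false) * x (false, true)))
    ∧ ((x (true, true) + x (false, false) - p' * q' - (1 - p') * (1 - q'))
          * (x (true, true) * x (false, false) - x (true, false) * x (false, true)) ≤ 0 →
      (2 * t - 1) ^ 2 ≤ 1 - 4 * |x (true, true) * x (false, false) - x (true, false) * x (false, true)|) := by
  set y : Bool × Bool → ℝ := fun w => (if w.1 then p' else 1 - p') * (if w.2 then q' else 1 - q')
    with hydef
  have hy0 : ∀ z, 0 ≤ y z := by
    rintro ⟨i, j⟩; cases i <;> cases j <;> simp [hydef] <;> nlinarith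
  have hys : y (true, true) + y (true, false) + y (false, true) + y (false, false) = 1 := by
    simp [hydef]; ring
  have hdet : y (true, true) * y (false, false) - y (true, false) * y (false, true) = 0 := by
    simp [hydef]; ring
  have hydiag : y (true, true) + y (false, false) = p' * q' + (1 - p') * (1 - q') := by
    simp [hydef]
  have ht' : t ≤ ∑ z : Bool × Bool, ∑ w : Bool × Bool, min (x z * y w) (x w * y z) := by
    simpa [hydef] using ht
  -- the sixteen-term sum is symmetric under `x ↔ y`
  have hswap : ∑ z : Bool × Bool, ∑ w : Bool × Bool, min (y z * x w) (y w * x z)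
      = ∑ z : Bool × Bool, ∑ w : Bool × Bool, min (x z * y w) (x w * y z) := by
    refine Finset.sum_congr rfl fun z _ => Finset.sum_congr rfl fun w _ => ?_
    rw [min_comm]; ring_nf
  have hA : x (true, true) + x (false, false) ≤ p' * q' + (1 - p') * (1 - q') →
      (2 * t - 1) ^ 2
        ≤ 1 - 4 * (x (true, true) * x (false, false) - x (true, false) * x (false, true)) := by
    intro hle
    have h := curve_of_diag_le x y hx0 hy0 hs hys (by rw [hydiag]; exact hle) ht' ht2
    simpa [hdet] using h
  have hB : p' * q' + (1 - p') * (1 - q') ≤ x (true, true) + x (false, false) →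
      (2 * t - 1) ^ 2
        ≤ 1 + 4 * (x (true, true) * x (false, false) - x (true, false) * x (false, true)) := by
    intro hle
    have h := curve_of_diag_le y x hy0 hx0 hys hs (by rw [hydiag]; exact hle) (t := t)
      (by rw [hswap]; exact ht') ht2
    rw [hdet] at h; linarith
  refine ⟨hA, hB, ?_⟩
  intro hprod
  rcases le_total (x (true, true) + x (false, false)) (p' * q' + (1 - p') * (1 - q')) with hle | hle
  · rcases le_or_gt 0 (x (true, true) * x (false, false) - x (true, false) * x (false, true))
      with hd | hd
    · rw [abs_of_nonneg hd]; exact hA hle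
    · -- here the product hypothesis forces `x(diag) = y(diag)`, so both halves apply
      have heq : x (true, true) + x (false, false) = p' * q' + (1 - p') * (1 - q') := by
        by_contra hne
        have hlt : x (true, true) + x (false, false) - p' * q' - (1 - p') * (1 - q') < 0 := by
          rcases lt_or_eq_of_le hle with h' | h'
          · linarith
          · exact absurd h' hne
        nlinarith
      rw [abs_of_neg hd]; have := hB heq.ge; linarith
  · rcases le_or_gt (x (true, true) * x (false, false) - x (true, false) * x (false, true)) 0
      with hd | hd
    · rw [abs_of_nonpos hd]; have := hB hle; linarith
    · have heq : x (true, true) + x (false, false) = p' * q' + (1 - p') * (1 - q') := by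
        by_contra hne
        have hlt : 0 < x (true, true) + x (false, false) - p' * q' - (1 - p') * (1 - q') := by
          rcases lt_or_eq_of_le hle with h' | h'
          · linarith
          · exact absurd h'.symm hne
        nlinarith
      rw [abs_of_pos hd]; exact hA heq.le

end Summit.Ventures.LatticeQCDFlow.TrivializingMaps.Curve
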